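import Literature.Barriers.CriticalPhenomena.GaussianDominationRouteLatticeConv
import Literature.Probability.Percolation.InfraredTriangleAnalysis
import HarnessLib

/-!
# Towards `HvdH2017_prop83` (hence `HvdH2017_lemma812_holds`, `HaraSlade1990_infraredBound_holds`):
# Fourier inversion and Parseval for the cosine transform `cosFT` on `ℤ^d`

Sibling proof file of `GaussianDominationRoute*.lean` (barrier catalogue
`Literature/Barriers/CriticalPhenomena/`). The proofs of Heydenreich–van der Hofstad's Lemmas 8.5–8.7
(the bounds on the diagrams `Δ̃_p`, `W_p`, `H_p` under the bootstrap assumption `f(p) ≤ K`, which with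
Prop. 7.4 give Lemma 8.4 and Prop. 8.3) pass between lattice sums and integrals over the Brillouin
zone at every step ("In terms of the Fourier transform, this gives …" (8.3.13); "we use the Fourier
inversion theorem" (8.3.18), (8.3.21), (8.3.26), (8.3.28), (8.3.32)). This file supplies that
passage for the real cosine transform `cosFT f k = Σ_x cos(k·x) f(x)` of the tree
(`GaussianDominationRouteImprovement.lean`; `tauHat d p = cosFT (τ_p(0,·))`) and Lebesgue measure on
the closed cube `cube d = [-π,π]^d`:

* `integral_cube_cos_kdot_mul_cos_kdot` — orthogonality
  `∫_{[-π,π]^d} cos(k·x) cos(k·y) dk = ½(2π)^d [𝟙{x+y=0} + 𝟙{x=y}]` (via `∫ cos(k·z) dk = (2π)^d 𝟙{z=0}`,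
  the real part of `integral_cexp_neg_kdot` of `InfraredTriangleAnalysis.lean`);
* `integral_cube_cos_kdot_mul_cosFT` — **inversion**: `∫ cos(k·x) f̂(k) dk = (2π)^d f(x)` for
  symmetric summable `f` (HvdH (1.2.17) `f(x) = ∫ e^{-ik·x} f̂(k) dk/(2π)^d`);
* `integral_cube_cosFT_mul_cosFT` — **Parseval**: `∫ f̂(k) ĝ(k) dk = (2π)^d Σ_x f(x) g(x)` for
  summable `f` and symmetric summable `g`;
* `integral_cube_cosFT` (`∫ f̂ = (2π)^d f(0)`), `integral_cube_cosFT_sq` (Plancherel), continuity of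
  `cosFT` (`continuous_cosFT`), integrability on the cube of products of transforms.

Sums and integrals are interchanged by `integral_tsum_of_summable_integral_norm` (domination by
`Σ|f| · (2π)^d`).

## References

* M. Heydenreich, R. van der Hofstad, *Progress in High-Dimensional Percolation and Random
  Graphs* (Springer 2017): (1.2.16)–(1.2.17) (Fourier transform and inversion on `ℤ^d`),
  (5.1.7)–(5.1.8) (`Δ_p = ∫ τ̂_p³`), §8.3 ((8.3.13), (8.3.18), (8.3.21), (8.3.26)).
-/

noncomputable section

namespace Literature.Barriers.CriticalPhenomena

open MeasureTheory Filter Topology Real Literature.Probability.LatticeModels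
  Literature.Probability.Percolation Slade2006Prop53
open scoped BigOperators

variable {d : ℕ}

/-! ### The cube -/

/-- Lebesgue measure restricted to the cube is the product measure `Slade2006Prop53.P d`.
[folklore] -/
theorem volume_restrict_cube_eq_P : (volume : Measure (Fin d → ℝ)).restrict (cube d) = P d :=
  volume_restrict_cube d

/-- `P d` has total mass `(2π)^d`. [folklore] -/
theorem P_univ : P d Set.univ = ENNReal.ofReal ((2 * π) ^ d) := by
  have h1 : μI Set.univ = ENNReal.ofReal (2 * π) := by
    rw [μI, Measure.restrict_apply_univ, Real.volume_Icc]
    congr 1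
    ring
  rw [P, Measure.pi_univ]
  simp only [Finset.prod_const, Finset.card_univ, Fintype.card_fin, h1]
  rw [ENNReal.ofReal_pow (by positivity)]

/-- `vol([-π,π]^d) = (2π)^d` (real-valued). [folklore] -/
theorem measureReal_cube : (volume : Measure (Fin d → ℝ)).real (cube d) = (2 * π) ^ d := by
  rw [Measure.real, ← Measure.restrict_apply_univ, volume_restrict_cube_eq_P, P_univ,
    ENNReal.toReal_ofReal (by positivity)]

/-- The cube has finite volume. [folklore] -/
theorem volume_cube_ne_top : (volume : Measure (Fin d → ℝ)) (cube d) ≠ ⊤ := by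
  rw [← Measure.restrict_apply_univ (μ := volume) (s := cube d), volume_restrict_cube_eq_P]
  exact measure_ne_top _ _

/-- A continuous function bounded by `C` is integrable on the cube. [folklore] -/
theorem integrableOn_cube_of_continuous {F : (Fin d → ℝ) → ℝ} (hF : Continuous F) {C : ℝ}
    (hC : ∀ k, |F k| ≤ C) : IntegrableOn F (cube d) := by
  rw [IntegrableOn, volume_restrict_cube_eq_P]
  exact (integrable_const C).mono' hF.aestronglyMeasurable
    (ae_of_all _ fun k => by rw [Real.norm_eq_abs]; exact hC k)

/-- `k ↦ cos(k·x)` is continuous. [folklore] -/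
theorem continuous_cos_kdot (x : Site d) : Continuous fun k : Fin d → ℝ => Real.cos (kdot k x) := by
  unfold kdot; fun_prop

/-! ### Orthogonality -/

/-- `cos a cos b = ½[cos(a + b) + cos(a - b)]`. [folklore] -/
theorem cos_mul_cos_eq (a b : ℝ) :
    Real.cos a * Real.cos b = (Real.cos (a + b) + Real.cos (a - b)) / 2 := by
  rw [Real.cos_add, Real.cos_sub]; ring

/-- **Orthogonality of the cosines on the cube**:
`∫_{[-π,π]^d} cos(k·x) cos(k·y) dk = ½(2π)^d [𝟙{x + y = 0} + 𝟙{x = y}]` for `x, y ∈ ℤ^d` (from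
`∫ cos(k·z) dk = (2π)^d 𝟙{z = 0}`, the real part of `integral_cexp_neg_kdot`; the one-cosine
orthogonality is also `SpreadOutIsing.integral_cube_cos_kdot` of the Ising files, not imported here).
[cite: HeydenreichVanDerHofstad2017, (1.2.17) (Fourier inversion on ℤ^d)] -/
theorem integral_cube_cos_kdot_mul_cos_kdot (x y : Site d) :
    ∫ k in cube d, Real.cos (kdot k x) * Real.cos (kdot k y) =
      (2 * π) ^ d / 2 * ((if x + y = 0 then 1 else 0) + (if x = y then 1 else 0)) := by
  -- one cosine: `∫ cos(k·z) dk = (2π)^d 𝟙{z = 0}`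
  have key : ∀ z : Site d, ∫ k in cube d, Real.cos (kdot k z) = if z = 0 then (2 * π) ^ d else 0 := by
    intro z
    rw [volume_restrict_cube_eq_P]
    have hint : Integrable (fun k : Fin d → ℝ => Complex.exp (-(Complex.I * (kdot k z : ℝ)))) (P d) := by
      refine (integrable_const (1 : ℝ)).mono' ?_ (ae_of_all _ fun k => ?_)
      · have hc : Continuous fun k : Fin d → ℝ => Complex.exp (-(Complex.I * (kdot k z : ℝ))) := by
          unfold kdot; fun_prop
        exact hc.aestronglyMeasurable
      · rw [Complex.norm_exp]
        simp
    have hre : ∀ k : Fin d → ℝ, Real.cos (kdot k z) =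
        RCLike.re (Complex.exp (-(Complex.I * (kdot k z : ℝ)))) := by
      intro k
      rw [RCLike.re_to_complex, show -(Complex.I * ((kdot k z : ℝ) : ℂ)) =
        ((-kdot k z : ℝ) : ℂ) * Complex.I by push_cast; ring, Complex.exp_ofReal_mul_I_re,
        Real.cos_neg]
    simp_rw [hre]
    rw [integral_re hint, integral_cexp_neg_kdot z]
    split_ifs
    · rw [RCLike.re_to_complex, show ((2 * π : ℂ) ^ d) = (((2 * π) ^ d : ℝ) : ℂ) by push_cast; ring,
        Complex.ofReal_re]
    · simp
  have e : (fun k : Fin d → ℝ => Real.cos (kdot k x) * Real.cos (kdot k y)) =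
      fun k => (1 / 2) * Real.cos (kdot k (x + y)) + (1 / 2) * Real.cos (kdot k (x - y)) := by
    funext k
    rw [cos_mul_cos_eq, kdot_add, sub_eq_add_neg x y, kdot_add, kdot_neg, ← sub_eq_add_neg]
    ring
  have hi : ∀ z : Site d, IntegrableOn (fun k : Fin d → ℝ => (1 / 2) * Real.cos (kdot k z)) (cube d) :=
    fun z => integrableOn_cube_of_continuous (continuous_const.mul (continuous_cos_kdot z))
      (C := 1 / 2) fun k => by
        rw [abs_mul, abs_of_pos (by norm_num : (0 : ℝ) < 1 / 2)]
        linarith [Real.abs_cos_le_one (kdot k z)]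
  rw [e, integral_add (hi _) (hi _), integral_const_mul, integral_const_mul, key, key]
  have hxy : x - y = 0 ↔ x = y := sub_eq_zero
  by_cases h2 : x = y
  · rw [if_pos (hxy.2 h2), if_pos h2]
    split_ifs <;> ring
  · rw [if_neg (fun h => h2 (hxy.1 h)), if_neg h2]
    split_ifs <;> ring

/-! ### Continuity and boundedness of `cosFT` -/

/-- `f̂` is continuous for summable `f` (uniformly convergent cosine series). [folklore] -/
theorem continuous_cosFT {f : Site d → ℝ} (hf : Summable f) : Continuous (cosFT f) := by
  unfold cosFT
  refine continuous_tsum (fun x => ?_) hf.abs fun x k => ?_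
  · exact (continuous_cos_kdot x).mul continuous_const
  · rw [Real.norm_eq_abs, abs_mul]
    exact mul_le_of_le_one_left (abs_nonneg _) (Real.abs_cos_le_one _)

/-- `cos(k·x) f̂(k)` is integrable on the cube. [folklore] -/
theorem integrableOn_cos_kdot_mul_cosFT {f : Site d → ℝ} (hf : Summable f) (x : Site d) :
    IntegrableOn (fun k => Real.cos (kdot k x) * cosFT f k) (cube d) :=
  integrableOn_cube_of_continuous ((continuous_cos_kdot x).mul (continuous_cosFT hf)) (C := ∑' y, |f y|) fun k => by
      rw [abs_mul]
      exact (mul_le_of_le_one_left (abs_nonneg _) (Real.abs_cos_le_one _)).trans (abs_cosFT_le hf k)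

/-- `f̂(k) ĝ(k)` is integrable on the cube. [folklore] -/
theorem integrableOn_cosFT_mul_cosFT {f g : Site d → ℝ} (hf : Summable f) (hg : Summable g) :
    IntegrableOn (fun k => cosFT f k * cosFT g k) (cube d) :=
  integrableOn_cube_of_continuous ((continuous_cosFT hf).mul (continuous_cosFT hg))
    (C := (∑' x, |f x|) * ∑' y, |g y|) fun k => by
      rw [abs_mul]
      exact mul_le_mul (abs_cosFT_le hf k) (abs_cosFT_le hg k) (abs_nonneg _)
        (tsum_nonneg fun x => abs_nonneg _)

/-! ### Inversion -/

/-- **Fourier inversion for the cosine transform**: for symmetric summable `f : ℤ^d → ℝ` and every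
`x`, `∫_{[-π,π]^d} cos(k·x) f̂(k) dk = (2π)^d f(x)`.
[cite: HeydenreichVanDerHofstad2017, (1.2.16)–(1.2.17)] -/
theorem integral_cube_cos_kdot_mul_cosFT {f : Site d → ℝ} (hf : Summable f)
    (hsym : ∀ x, f (-x) = f x) (x : Site d) :
    ∫ k in cube d, Real.cos (kdot k x) * cosFT f k = (2 * π) ^ d * f x := by
  -- expand `f̂` and interchange sum and integral
  set F : Site d → (Fin d → ℝ) → ℝ := fun y k => f y * (Real.cos (kdot k x) * Real.cos (kdot k y))
    with hF
  have h1 : ∀ k, Real.cos (kdot k x) * cosFT f k = ∑' y, F y k := fun k => by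
    rw [cosFT, ← tsum_mul_left]
    exact tsum_congr fun y => by simp only [hF]; ring
  simp_rw [h1]
  have hFi : ∀ y, IntegrableOn (F y) (cube d) := fun y =>
    integrableOn_cube_of_continuous (continuous_const.mul ((continuous_cos_kdot x).mul (continuous_cos_kdot y))) (C := |f y|) fun k => by
        simp only [hF]
        rw [abs_mul, abs_mul]
        exact mul_le_of_le_one_right (abs_nonneg _)
          (mul_le_one₀ (Real.abs_cos_le_one _) (abs_nonneg _) (Real.abs_cos_le_one _))
  have hFn : ∀ y, ∫ k in cube d, ‖F y k‖ ≤ |f y| * (2 * π) ^ d := fun y => by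
    calc ∫ k in cube d, ‖F y k‖ ≤ ∫ k in cube d, |f y| := by
          refine integral_mono (hFi y).norm (integrableOn_const volume_cube_ne_top) fun k => ?_
          simp only [hF]
          rw [Real.norm_eq_abs, abs_mul, abs_mul]
          exact mul_le_of_le_one_right (abs_nonneg _)
            (mul_le_one₀ (Real.abs_cos_le_one _) (abs_nonneg _) (Real.abs_cos_le_one _))
      _ = |f y| * (2 * π) ^ d := by
          rw [setIntegral_const, measureReal_cube, smul_eq_mul, mul_comm]
  have hFs : Summable fun y => ∫ k in cube d, ‖F y k‖ :=
    Summable.of_nonneg_of_le (fun y => integral_nonneg fun k => norm_nonneg _) hFn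
      (hf.abs.mul_right _)
  rw [← integral_tsum_of_summable_integral_norm hFi hFs]
  -- the `y`-th integral
  have h2 : ∀ y, ∫ k in cube d, F y k =
      (2 * π) ^ d / 2 * ((if y = -x then f (-x) else 0) + (if y = x then f x else 0)) := fun y => by
    simp only [hF]
    rw [integral_const_mul, integral_cube_cos_kdot_mul_cos_kdot]
    have e1 : (if x + y = 0 then (1 : ℝ) else 0) * f y = if y = -x then f (-x) else 0 := by
      by_cases h : y = -x
      · subst h; simp
      · rw [if_neg h, if_neg (fun h' => h (eq_neg_of_add_eq_zero_right h'))]; ring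
    have e2 : (if x = y then (1 : ℝ) else 0) * f y = if y = x then f x else 0 := by
      by_cases h : y = x
      · subst h; simp
      · rw [if_neg h, if_neg (fun h' => h h'.symm)]; ring
    calc f y * ((2 * π) ^ d / 2 * ((if x + y = 0 then 1 else 0) + (if x = y then 1 else 0)))
        = (2 * π) ^ d / 2 * ((if x + y = 0 then (1 : ℝ) else 0) * f y +
            (if x = y then (1 : ℝ) else 0) * f y) := by ring
      _ = _ := by rw [e1, e2]
  simp_rw [h2]
  rw [tsum_mul_left, (hasSum_ite_eq (-x) (f (-x))).summable.tsum_add (hasSum_ite_eq x (f x)).summable,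
    (hasSum_ite_eq (-x) (f (-x))).tsum_eq, (hasSum_ite_eq x (f x)).tsum_eq, hsym]
  ring

/-- In particular `∫_{[-π,π]^d} f̂(k) dk = (2π)^d f(0)`. [cite: HeydenreichVanDerHofstad2017, (1.2.17)] -/
theorem integral_cube_cosFT {f : Site d → ℝ} (hf : Summable f) (hsym : ∀ x, f (-x) = f x) :
    ∫ k in cube d, cosFT f k = (2 * π) ^ d * f 0 := by
  have h := integral_cube_cos_kdot_mul_cosFT hf hsym 0
  simpa using h

/-! ### Parseval -/

/-- **Parseval for the cosine transform**: for summable `f` and symmetric summable `g`,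
`∫_{[-π,π]^d} f̂(k) ĝ(k) dk = (2π)^d Σ_x f(x) g(x)`.
[cite: HeydenreichVanDerHofstad2017, (1.2.16)–(1.2.17) and (8.3.18)] -/
theorem integral_cube_cosFT_mul_cosFT {f g : Site d → ℝ} (hf : Summable f) (hg : Summable g)
    (hsym : ∀ x, g (-x) = g x) :
    ∫ k in cube d, cosFT f k * cosFT g k = (2 * π) ^ d * ∑' x, f x * g x := by
  set F : Site d → (Fin d → ℝ) → ℝ := fun x k => f x * (Real.cos (kdot k x) * cosFT g k) with hF
  have h1 : ∀ k, cosFT f k * cosFT g k = ∑' x, F x k := fun k => by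
    rw [cosFT, ← tsum_mul_right]
    exact tsum_congr fun x => by simp only [hF]; ring
  simp_rw [h1]
  have hB : ∀ x k, |Real.cos (kdot k x) * cosFT g k| ≤ ∑' y, |g y| := fun x k => by
    rw [abs_mul]
    exact (mul_le_of_le_one_left (abs_nonneg _) (Real.abs_cos_le_one _)).trans (abs_cosFT_le hg k)
  have hFi : ∀ x, IntegrableOn (F x) (cube d) := fun x =>
    integrableOn_cube_of_continuous (continuous_const.mul ((continuous_cos_kdot x).mul (continuous_cosFT hg))) (C := |f x| * ∑' y, |g y|) fun k => by
        simp only [hF]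
        rw [abs_mul]
        exact mul_le_mul_of_nonneg_left (hB x k) (abs_nonneg _)
  have hFn : ∀ x, ∫ k in cube d, ‖F x k‖ ≤ |f x| * ((∑' y, |g y|) * (2 * π) ^ d) := fun x => by
    calc ∫ k in cube d, ‖F x k‖ ≤ ∫ k in cube d, |f x| * ∑' y, |g y| := by
          refine integral_mono (hFi x).norm (integrableOn_const volume_cube_ne_top) fun k => ?_
          simp only [hF]
          rw [Real.norm_eq_abs, abs_mul]
          exact mul_le_mul_of_nonneg_left (hB x k) (abs_nonneg _)
      _ = |f x| * ((∑' y, |g y|) * (2 * π) ^ d) := by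
          rw [setIntegral_const, measureReal_cube, smul_eq_mul]; ring
  have hFs : Summable fun x => ∫ k in cube d, ‖F x k‖ :=
    Summable.of_nonneg_of_le (fun x => integral_nonneg fun k => norm_nonneg _) hFn
      (hf.abs.mul_right _)
  rw [← integral_tsum_of_summable_integral_norm hFi hFs]
  have h2 : ∀ x, ∫ k in cube d, F x k = (2 * π) ^ d * (f x * g x) := fun x => by
    simp only [hF]
    rw [integral_const_mul, integral_cube_cos_kdot_mul_cosFT hg hsym]
    ring
  simp_rw [h2]
  exact tsum_mul_left

/-- Parseval with the symmetric factor first. [folklore] -/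
theorem integral_cube_cosFT_mul_cosFT' {f g : Site d → ℝ} (hf : Summable f) (hsym : ∀ x, f (-x) = f x)
    (hg : Summable g) :
    ∫ k in cube d, cosFT f k * cosFT g k = (2 * π) ^ d * ∑' x, f x * g x := by
  simp_rw [mul_comm (cosFT f _)]
  rw [integral_cube_cosFT_mul_cosFT hg hf hsym]
  exact congrArg _ (tsum_congr fun x => mul_comm _ _)

/-- **Plancherel**: `∫_{[-π,π]^d} f̂(k)² dk = (2π)^d Σ_x f(x)²` for symmetric summable `f`.
[cite: HeydenreichVanDerHofstad2017, (1.2.16)–(1.2.17)] -/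
theorem integral_cube_cosFT_sq {f : Site d → ℝ} (hf : Summable f) (hsym : ∀ x, f (-x) = f x) :
    ∫ k in cube d, cosFT f k ^ 2 = (2 * π) ^ d * ∑' x, f x ^ 2 := by
  simp_rw [sq]
  exact integral_cube_cosFT_mul_cosFT hf hf hsym

end Literature.Barriers.CriticalPhenomena

end
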